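import Literature.MathematicalPhysics.QuantumFieldTheory.BalabanImbrieJaffe1984to88.BIJ88RT51Background

/-!
# `BalabanImbrieJaffe1984to88.BIJ88RT51Background42` — T. Bałaban, J. Imbrie, A. Jaffe, *Effective action and cluster properties of
the abelian Higgs model*, Commun. Math. Phys. **114** (1988) 257–315 [BalabanImbrieJaffe1988], (4.2) p. 274 and (4.17) p. 277 / (5.1.4)
p. 278: **the (4.2)-SHAPED background fields `u_k = (Q^{s*}_ku)·w(u)` at GROUP level and their transformation law** — for every
gauge-invariant `U(1)`-valued η-bond field `w(u)` (the printed factor `exp[−ie_kη(𝒟_{k,loc}∂*Q^{e*}_kf^{(k)})(b)]` is one), `u_k` TRANSFORMS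
BY `Q′*_kλ = λ∘(k-fold block map)` under EVERY gauge transformation `λ` of the unit lattice; hence every kernel hypothesis of the (5.1.1)
theorems — (5.1.4) *"no change is made"*, (4.17) block field gauge covariance, existence of an exactly invariant `ρ̃^L_{k+1}` — is
DISCHARGED for `Q(u_k)φ` with `u_k` of the form (4.2) (companion of `BIJ88RT51Background`, same seat).

statement-level skeleton of published theorems with citation tags; proofs where landed; nothing here is a claim about the Yang–Mills mass gap

PDF held: `paper:balaban1988-cmp114-bij-abelian-higgs-effective-action` (journal page = PDF page + 256); pp. 274, 277–278 [PDF 18, 21–22]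
read as images (r16's renders `HOME/lit-balaban-r16/renders/cmp114/original-p018-x2.png`, `original-p021-x2.png`, `original-p022-x2.png`).

CITATION HEADER (lean-in-tree rule).  Part of the lit-balaban TYPED SKELETON (HOME `run/shared/lean/pub/lit-balaban/`), PHASE-2 proof
seat p34 gen 7 (unit `lit-balaban-p34-g7`; TAKING line HOME/STATUS.md 2026-08-21T10:52:30Z, free-target protocol G.5-34(d), own
lineage = the C1/C2 renormalization-transformation line).  Rows served (support): `C2.Eq4.2`, `C2.Eq4.17` of `HOME/lit-balaban-r18/ROWS-C2.md`
(owner r18) and `C2.Eq5.1.1-5.1.4` / `C2.Eq5.2.9` of `HOME/lit-balaban-r16/ROWS-C2-part2.md` (owner r16).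

THE PRINTED TEXT (verbatim).  p. 274 [PDF 18]: *"The external gauge field appearing throughout the initial density is u_k. It depends on
all the u^{(j)} [or equivalently, the A^{(j)} = (ie_j)⁻¹ log u^{(j)}]; but in Λ̄₆^{(k−1)*} it simplifies to
u_k = (Q^{s*}_ku) exp(−ie_kη𝒟_{k,loc}∂*Q^{e*}_k f^{(k)}), (4.2) where f^{(k)}(p) = (ie_k)⁻¹ log u(p)."*  p. 277 [PDF 21]: *"The dependence of
u_k and u and the u^{(j)} is such that the above transformations induce the gauge transformation u_{k,b} → u_{k,b} exp[−ie_kη(∂^ηQ′*_kλ)], and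
thus we have invariance in the previous sense."*  p. 278 [PDF 22]: *"Since u_k also transforms by λ, we have Q(u_k)φ invariant as well."*

THE READING.  `Q^{s*}_k` = [2] (4.5.3), the pull-back of GROUP-valued configurations from the unit lattice `T₁^{(k)} = T^{(k)}` to
`T_η = T^{(0)}` — p31's base-`0` composite `BIJ85Eq453GaugeField.qsstarGIter0 k` (decl of record; any group).  The ℂ-valued reading of
(4.2) of record is r18's `BIJ88Sect4Statements.backgroundU ek η (cfg (Q^{s*}_ku)) corr` (`corr = 𝒟_{k,loc}∂*Q^{e*}_kf^{(k)}`, a real η-bond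
field); to feed the group-valued objects of (4.4)/(5.1.1) (`barU`, `qCov`) the same field is written here at GROUP level,
`bg42 k w u := b ↦ (Q^{s*}_ku)(b)·w(u)(b)` with `w(u)(b) = exp[−ie_kη·corr(u)(b)] ∈ U(1)` — dictionary `cfg_bg42` — and, since the
operators `𝒟_{k,loc}`, `∂*`, `Q^{e*}_k` of Sect. 4 are statement-level data in the tree, for an ARBITRARY correction factor `w(u)` that is a
gauge-invariant function of `u` (the printed one is: it is a function of the plaquette field strengths `f^{(k)}`, which are gauge invariant —
r18's `BIJ88BlockGauge417.fieldStrength_plaqVar_gaugeAct`; `gaugeInvariant_expCorr` below).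

WHAT IS PROVED (kernel-checked; one `def` with body (`bg42`), no `Prop`-valued fact; standard axioms).
* §1 `Q^{s*}_k` at base `0`: **`qsstarGIter0_gaugeAct`** — `Q^{s*}_k(u^λ) = (Q^{s*}_ku)^{λ∘iterBlockOf k}` for EVERY gauge transformation `λ`
  of `T₁^{(k)}` and every group (the base-`0` form of p31's `qsstarGIter_gaugeAct`); `measurable_qsstarG`, `measurable_qsstarGIter0`.
* §2 the (4.2)-shaped backgrounds: `bg42`, `cfg_bg42` (= r18's `backgroundU` read in `ℂ`), **`bg42_gaugeAct`** (p. 277 *"induce the gauge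
  transformation u_{k,b} → u_{k,b}exp[−ie_kη(∂^ηQ′*_kλ)]"* and p. 278 *"u_k also transforms by λ"*: `u_k(u^λ) = u_k(u)^{λ∘iterBlockOf k}` for
  every `λ` and every gauge-invariant `w`), `gaugeInvariant_expCorr` (the printed correction factor qualifies), `barU_mul`/`barU_bg42`
  (`ū_k = u·ū(w(u))`: by (4.4) and `BIJ88RT51Background.barU_qsstarGIter0`), `bg42_one`/`qCov_barU_bg42_one` (no correction ⇒ `Q(u_k)φ =
  Q(u)φ`, the first-step kernel of (3.11)), `measurable_bg42`.
* §3 assembly: for term data whose background maps are `u_k = bg42 k (w_t) u` (the `Λ̄₆^{(k−1)*}` form (4.2); `w_t` measurable and gauge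
  invariant) ALL kernel hypotheses of gen 5's `BIJ88RT51NoChange.isRT511_iff_isRT511Ax`, `BIJ88RT51BlockGauge.isRT511(Ax)_blockGauge` and gen 6's
  `BIJ88RT51Invariant.exists_isRT511(Ax)_jointInvariant` are discharged (via file 1's `…_background` theorems with `λ₀ = λ∘iterBlockOf k`,
  resp. `(g∘y)∘iterBlockOf k`): `isRT511_iff_isRT511Ax_bg42`, `isRT511_blockGauge_bg42`, `isRT511Ax_blockGauge_bg42`,
  `exists_isRT511_jointInvariant_bg42`, `exists_isRT511Ax_jointInvariant_bg42` — only hypotheses on `Qu` (printed `qU` in the last two) and on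
  the term densities `ρ′_t` remain.
* §4 (v1.1) FULLY PRINTED INSTANCES, one history-free term: `exists_isRT511_jointInvariant_bg42_single` (`ρ′ = ρ₀(u, φ)` jointly measurable,
  jointly gauge invariant, `𝒟u𝒟φ`-integrable; any measurable gauge-invariant correction `w`), **`exists_isRT511_jointInvariant_bg42_rho0`** (the
  model's `ρ₀ = F e^{−S}` of (3.7) = r18's `rho0`, for the observables `F` of (3.1): measurable, jointly gauge invariant, `|F| ≤ CΠ_x(1 + |φ(x)|)ⁿ`;
  r18's `measurable_rho0`/`rho0_gaugeAct`, ref-2's `BIJ88Rho0Integrable.integrable_rho0`) and `exists_isRT511_jointInvariant_expCorr_rho0` (the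
  printed correction `exp[−ie_kη(Df^{(k)})]`): the renormalization transformation (5.1.1) with the printed `Qu`, the kernel `Q(u_k)φ` of a
  (4.2)-shaped background and the model's density HAS an exactly block-field gauge invariant, measurable, `dv dψ`-integrable `ρ̃^L_{k+1}` —
  no hypothesis left on the renormalization-transformation side (`ε, λ, a > 0`, `d ≥ 2`, standing range).
NOT DONE HERE (honest scope).  `u_k` outside `Λ̄₆^{(k−1)*}` (p. 274 *"quite complicated"* — file 1 keeps it an abstract map); the operators
`𝒟_{k,loc}∂*Q^{e*}_k` themselves (Sect. 2/4 data); any bound.  Imports `BIJ88RT51Background` only (Literature + Mathlib); re-declares nothing.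
-/

namespace Literature.MathematicalPhysics.QuantumFieldTheory.BalabanImbrieJaffe1984to88.BIJ88RT51Background42

open Literature.MathematicalPhysics.QuantumFieldTheory.Balaban1983to89
open BIJ88Sect3Statements (U1 toC toC_one toC_mul cfg plaqVar fieldStrength)
open BIJ88Sect3Rescaling (toC_injective_U1)
open BIJ85Sect1Model (HiggsField)
open BIJ85RT33 (JointInvariant twist)
open BIJ88RenormTransf311 (axialMeasure rho0 measurable_rho0 rho0_gaugeAct)
open BIJ85BlockAveragesTorus (corner qU qCov expU1 toC_expU1 toC_inv' measurable_qU measurable_expU1)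
open BIJ88InductiveForm41 (Prev prevMeasure)
open BIJ88BlockGauge417 (fieldStrength_plaqVar_gaugeAct)
open BIJ88RT51GeneralStep (IsRT511 IsRT511Ax IsPointed)
open BIJ88Sect4Statements (barU backgroundU)
open BIJ88Eq44OneStroke (toC_barU)
open B15DeterminingSets (embIter)
open B5Eq118OneStroke (iterBlockOf iterBlockOf_succ)
open BIJ85Eq453GaugeField (qsstarG qsstarG_apply qsstarGIter0 qsstarGIter0_succ qsstarG_gaugeAct)
open BIJ88RT51Background (iterBlockOf_embIter barU_qsstarGIter0 isRT511_iff_isRT511Ax_background isRT511_blockGauge_background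
  isRT511Ax_blockGauge_background exists_isRT511_jointInvariant_background exists_isRT511Ax_jointInvariant_background)
open GaugeField (gaugeAct GaugeInvariant)
open scoped BigOperators
open _root_.MeasureTheory _root_.MeasureTheory.Measure Complex Function

noncomputable section

variable {P : Params}

/-! ## §1 `Q^{s*}_k` from the unit lattice to `T_η` (p31's base-`0` composite): gauge covariance for every `λ`, measurability -/

section Qsstar

variable {G : Type*}

/-- **`Q^{s*}_k(u^λ) = (Q^{s*}_ku)^{Q′*_kλ}` for EVERY gauge transformation `λ` of the unit lattice** (`Q′*_kλ = λ∘iterBlockOf k`, the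
pull-back constant on `k`-blocks): the mechanism of p. 277 *"induce the gauge transformation u_{k,b} → u_{k,b}exp[−ie_kη(∂^ηQ′*_kλ)]"* and of
p. 278 *"u_k also transforms by λ"*, for the base-`0` composite `qsstarGIter0` of [2] (4.5.3) (p31's one-step `qsstarG_gaugeAct` iterated;
any gauge group; standing range `k ≤ m + K`). [cite: BalabanImbrieJaffe1988, (4.17) p.277] -/
theorem qsstarGIter0_gaugeAct [GaugeGroup G] : ∀ (k : ℕ), k ≤ P.m + P.K → ∀ (g : GaugeTransf P k G) (V : GaugeField P k G),
    qsstarGIter0 k (gaugeAct g V) = gaugeAct (fun x => g (iterBlockOf k x)) (qsstarGIter0 k V)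
  | 0, _, _, _ => rfl
  | k + 1, hk, g, V => by
    rw [qsstarGIter0_succ, qsstarGIter0_succ, qsstarG_gaugeAct hk g V, qsstarGIter0_gaugeAct k (by omega)]
    rfl

variable [MeasurableSpace G]

/-- kernel: the one-step pull-back (4.5.3) is measurable (each bond variable of `Q^{s*}V` is `1` or a bond variable of `V`).
[cite: BalabanImbrieJaffe1985, (4.5.3) p.312] -/
theorem measurable_qsstarG [One G] {j : ℕ} : Measurable (qsstarG : GaugeField P (j+1) G → GaugeField P j G) := by
  refine measurable_pi_iff.mpr fun b => ?_
  by_cases h : blockOf b.tgt = blockOf b.src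
  · simp only [qsstarG_apply, if_pos h]
    exact measurable_const
  · simp only [qsstarG_apply, if_neg h]
    exact measurable_pi_apply _

/-- kernel: `Q^{s*}_k` is measurable. [cite: BalabanImbrieJaffe1985, (4.5.3) p.312] -/
theorem measurable_qsstarGIter0 [One G] : ∀ k : ℕ, Measurable (qsstarGIter0 k : GaugeField P k G → GaugeField P 0 G)
  | 0 => measurable_id
  | k + 1 => by
    rw [show (qsstarGIter0 (k+1) : GaugeField P (k+1) G → GaugeField P 0 G) = fun V => qsstarGIter0 k (qsstarG V) from
      funext fun V => qsstarGIter0_succ k V]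
    exact (measurable_qsstarGIter0 k).comp measurable_qsstarG

end Qsstar

/-! ## §2 The (4.2)-shaped backgrounds `u_k = (Q^{s*}_ku)·w(u)` at group level -/

section Bg

variable {k : ℕ}

/-- **(4.2) at group level**: the background field on `T_η` built from the unit-lattice field `u` as `u_{k,b} = (Q^{s*}_ku)(b)·w(u)(b)`,
`w(u)` a `U(1)`-valued η-bond field depending on `u` — the printed one is `w(u)(b) = exp[−ie_kη(𝒟_{k,loc}∂*Q^{e*}_k f^{(k)})(b)]`,
`f^{(k)}(p) = (ie_k)⁻¹log u(p)` (r18's ℂ-valued decl of record `BIJ88Sect4Statements.backgroundU`: dictionary `cfg_bg42`).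
[cite: BalabanImbrieJaffe1988, (4.2) p.274] -/
def bg42 (k : ℕ) (w : GaugeField P k U1 → GaugeField P 0 U1) (U : GaugeField P k U1) : GaugeField P 0 U1 :=
  fun b => qsstarGIter0 k U b * w U b

/-- unfolding. [cite: BalabanImbrieJaffe1988, (4.2) p.274] -/
theorem bg42_apply (w : GaugeField P k U1 → GaugeField P 0 U1) (U : GaugeField P k U1) (b : PBond P 0) :
    bg42 k w U b = qsstarGIter0 k U b * w U b := rfl

/-- **Dictionary with the decl of record**: read in `ℂ` (`cfg`), the group-level background with the exponential correction factor
`w(u)(b) = e^{−ie_kη·corr(u)(b)}` IS r18's `backgroundU ek η (cfg (Q^{s*}_ku)) (corr u)` of (4.2). [cite: BalabanImbrieJaffe1988, (4.2) p.274] -/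
theorem cfg_bg42 (ek η : ℝ) (corr : GaugeField P k U1 → PBond P 0 → ℝ) (U : GaugeField P k U1) :
    cfg (bg42 k (fun U b => expU1 (-(ek * η * corr U b))) U) = backgroundU ek η (cfg (qsstarGIter0 k U)) (corr U) := by
  funext b
  simp only [cfg, bg42, backgroundU, toC_mul, toC_expU1]
  congr 1
  push_cast
  ring_nf

/-- kernel: `U(1)` is commutative (read in `ℂ`). [folklore] -/
private theorem mul_comm_U1 (a b : U1) : a * b = b * a :=
  toC_injective_U1 (by rw [toC_mul, toC_mul, mul_comm])

/-- **p. 277 / p. 278, verbatim: *"the above transformations induce the gauge transformation u_{k,b} → u_{k,b}exp[−ie_kη(∂^ηQ′*_kλ)]"*,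
*"u_k also transforms by λ"* — PROVED for the (4.2)-shaped backgrounds**: for every gauge-invariant correction factor `w` and EVERY gauge
transformation `λ` of the unit lattice, `u_k(u^λ) = (u_k(u))^{λ∘iterBlockOf k}` — `Q^{s*}_k` is covariant (§1) and `w` does not move
(standing range). [cite: BalabanImbrieJaffe1988, (4.17) p.277] -/
theorem bg42_gaugeAct (hk : k ≤ P.m + P.K) {w : GaugeField P k U1 → GaugeField P 0 U1} (hw : GaugeInvariant w)
    (g : GaugeTransf P k U1) (U : GaugeField P k U1) :
    bg42 k w (gaugeAct g U) = gaugeAct (fun x => g (iterBlockOf k x)) (bg42 k w U) := by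
  funext b
  rw [bg42_apply, hw g U, qsstarGIter0_gaugeAct k hk g U]
  show gaugeAct (fun x => g (iterBlockOf k x)) (qsstarGIter0 k U) b * w U b = _
  simp only [GaugeField.gaugeAct, bg42_apply]
  rw [mul_assoc (g (iterBlockOf k b.src) * qsstarGIter0 k U b), mul_comm_U1 ((g (iterBlockOf k b.tgt))⁻¹) (w U b), ← mul_assoc,
    ← mul_assoc]

/-- **The printed correction factor qualifies**: `w(u)(b) = exp[−ie_kη·(D f^{(k)}(u))(b)]` is a gauge-invariant function of `u` for ANY map
`D` from plaquette functions to real η-bond fields (`D = 𝒟_{k,loc}∂*Q^{e*}_k` in (4.2)), because the field strengths `f^{(k)}(p) =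
(ie_k)⁻¹log u(p)` are gauge invariant (r18's `fieldStrength_plaqVar_gaugeAct`). [cite: BalabanImbrieJaffe1988, (4.2) p.274] -/
theorem gaugeInvariant_expCorr (ek η : ℝ) (D : (Balaban1983to89.Plaq P k → ℂ) → PBond P 0 → ℝ) :
    GaugeInvariant (fun (U : GaugeField P k U1) (b : PBond P 0) =>
      expU1 (-(ek * η * D (fun p => fieldStrength ek (plaqVar (cfg U) p)) b))) := by
  intro g U
  funext b
  simp only [fieldStrength_plaqVar_gaugeAct]

/-- kernel: in the abelian model the straight-line product (4.4) is multiplicative — `ū(u·u′) = ū(u)·ū(u′)` bondwise (ordered products of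
commuting factors; r18's `toC_barU`). [cite: BalabanImbrieJaffe1988, (4.4) p.274] -/
theorem barU_mul (hk : k ≤ P.m + P.K) (X W : GaugeField P 0 U1) :
    barU k (fun b => X b * W b) = fun c => barU k X c * barU k W c := by
  funext c
  apply toC_injective_U1
  rw [toC_mul, toC_barU hk, toC_barU hk, toC_barU hk, ← Finset.prod_mul_distrib]
  exact Finset.prod_congr rfl fun s _ => toC_mul _ _

/-- **`ū_k = u · ū(w(u))`**: the unit-lattice field (4.4) of a (4.2)-shaped background is `u` itself times the straight-line product of the
correction factor (`ū` of `Q^{s*}_ku` is `u`: file 1's `barU_qsstarGIter0`; standing range) — the sense in which *"ū_k"* of (4.5) is a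
small perturbation of `u`. [cite: BalabanImbrieJaffe1988, (4.4) p.274] -/
theorem barU_bg42 (hk : k ≤ P.m + P.K) (w : GaugeField P k U1 → GaugeField P 0 U1) (U : GaugeField P k U1) :
    barU k (bg42 k w U) = fun c => U c * barU k (w U) c := by
  rw [show bg42 k w U = fun b => qsstarGIter0 k U b * w U b from rfl, barU_mul hk, barU_qsstarGIter0 hk]

/-- No correction factor: `u_k = Q^{s*}_ku`. [cite: BalabanImbrieJaffe1988, (4.2) p.274] -/
theorem bg42_one (U : GaugeField P k U1) : bg42 k (fun _ _ => 1) U = qsstarGIter0 k U := by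
  funext b
  rw [bg42_apply, mul_one]

/-- **Consistency with the first step**: with no correction factor the kernel `Q(u_k)φ` of (5.1.1) IS the kernel `Q(u)φ` of (3.11) ([2]
(2.6), r18's `qCov`; standing range). [cite: BalabanImbrieJaffe1988, (5.1.1) p.277] -/
theorem qCov_barU_bg42_one (hk : k ≤ P.m + P.K) (U : GaugeField P k U1) (φ : HiggsField P k) :
    qCov (barU k (bg42 k (fun _ _ => 1) U)) φ = qCov U φ := by
  rw [bg42_one, barU_qsstarGIter0 hk]

/-- kernel: `u ↦ u_k` is measurable when the correction factor is (bondwise products of measurable coordinates).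
[cite: BalabanImbrieJaffe1988, (4.2) p.274] -/
theorem measurable_bg42 {w : GaugeField P k U1 → GaugeField P 0 U1} (hw : Measurable w) : Measurable (bg42 k w) := by
  refine measurable_pi_iff.mpr fun b => ?_
  show Measurable fun U => qsstarGIter0 k U b * w U b
  exact ((measurable_pi_apply b).comp (measurable_qsstarGIter0 k)).mul ((measurable_pi_apply b).comp hw)

/-- kernel: the printed correction factor is measurable in `u` whenever `D f^{(k)}` is (`expU1` continuous).
[cite: BalabanImbrieJaffe1988, (4.2) p.274] -/
theorem measurable_expCorr (ek η : ℝ) {D : (Balaban1983to89.Plaq P k → ℂ) → PBond P 0 → ℝ}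
    (hD : Measurable fun U : GaugeField P k U1 => D (fun p => fieldStrength ek (plaqVar (cfg U) p))) :
    Measurable fun (U : GaugeField P k U1) (b : PBond P 0) =>
      expU1 (-(ek * η * D (fun p => fieldStrength ek (plaqVar (cfg U) p)) b)) :=
  measurable_pi_iff.mpr fun b => measurable_expU1.comp ((((measurable_pi_apply b).comp hD).const_mul _).neg)

end Bg

/-! ## §3 Assembly: every kernel hypothesis of the (5.1.1) theorems discharged for the (4.2)-shaped backgrounds -/

section Assembly

variable {k : ℕ} {ι : Type*} {terms : Finset ι} {Qu : GaugeField P k U1 → GaugeField P (k+1) U1}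
variable {w : ι → GaugeField P k U1 → GaugeField P 0 U1} {a : ℝ}
variable {ρ' : ι → Prev P k → GaugeField P k U1 → HiggsField P k → ℂ}

/-- **(5.1.4) *"no change is made"* for (5.1.1) with `Q(u_k)φ`, `u_k` of the form (4.2)**: gen 5's `isRT511_iff_isRT511Ax` with EVERY
kernel hypothesis discharged — for measurable gauge-invariant correction factors `w_t`, a measurable pointed-invariant `Qu`, and term
densities `ρ′_t` jointly measurable and invariant under `({u^{(j)}}, u, φ) ↦ (τ_t(λ){u^{(j)}}, u^λ, λφ)` for pointed `λ` (`τ_t(λ)`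
`Π𝒟u^{(j)}`-preserving), `ρ̃` satisfies (5.1.1) iff it satisfies it with `δ_{Ax}(u)` inserted (standing range).
[cite: BalabanImbrieJaffe1988, (5.1.4) p.278] -/
theorem isRT511_iff_isRT511Ax_bg42 (hk : k + 1 ≤ P.m + P.K) (hQum : Measurable Qu) (hwm : ∀ t ∈ terms, Measurable (w t))
    (hw : ∀ t ∈ terms, GaugeInvariant (w t))
    (hρm : ∀ t ∈ terms, Measurable fun p : Prev P k × (GaugeField P k U1 × HiggsField P k) => ρ' t p.1 p.2.1 p.2.2)
    (hQu : ∀ g : GaugeTransf P k U1, IsPointed g → ∀ U, Qu (gaugeAct g U) = Qu U)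
    (τ : ι → GaugeTransf P k U1 → Prev P k ≃ᵐ Prev P k)
    (hτ : ∀ t ∈ terms, ∀ g : GaugeTransf P k U1, IsPointed g → MeasurePreserving (τ t g) (prevMeasure P k) (prevMeasure P k))
    (hρ : ∀ t ∈ terms, ∀ g : GaugeTransf P k U1, IsPointed g → ∀ prev U φ,
      ρ' t (τ t g prev) (gaugeAct g U) (twist g φ) = ρ' t prev U φ)
    (ρL : GaugeField P (k+1) U1 → HiggsField P (k+1) → ℂ) :
    IsRT511 terms Qu (fun t _ U φ => qCov (barU k (bg42 k (w t) U)) φ) a ρ' ρL ↔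
      IsRT511Ax terms Qu (fun t _ U φ => qCov (barU k (bg42 k (w t) U)) φ) a ρ' ρL :=
  isRT511_iff_isRT511Ax_background (uk := fun t _ U => bg42 k (w t) U) hk hQum
    (fun t ht => (measurable_bg42 (hwm t ht)).comp measurable_snd) hρm hQu τ hτ hρ
    (fun _ g => fun x => g (iterBlockOf k x)) (fun t _ g _ x => congrArg g (iterBlockOf_embIter k (by omega) x))
    (fun t ht g _ _ U => bg42_gaugeAct (by omega) (hw t ht) g U) ρL

/-- **Block field gauge covariance of (5.1.1) with `Q(u_k)φ`, `u_k` of the form (4.2)** (gen 5's `isRT511_blockGauge`, kernel hypothesis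
discharged): block-gauge covariant `Qu`, gauge-invariant `w_t`, `ρ′_t` invariant under `({u^{(j)}}, u, φ) ↦ (τ_t(g){u^{(j)}}, u^{g∘y}, (g∘y)φ)`
⟹ `(v, ψ) ↦ ρ̃(v^g, gψ)` satisfies (5.1.1) whenever `ρ̃` does (standing range). [cite: BalabanImbrieJaffe1988, (4.17) p.277] -/
theorem isRT511_blockGauge_bg42 (hk : k + 1 ≤ P.m + P.K) (hw : ∀ t ∈ terms, GaugeInvariant (w t))
    (hQu : ∀ (g : GaugeTransf P (k+1) U1) U, Qu (gaugeAct (fun x => g (blockOf x)) U) = gaugeAct g (Qu U))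
    (τ : ι → GaugeTransf P (k+1) U1 → Prev P k ≃ᵐ Prev P k)
    (hτ : ∀ t ∈ terms, ∀ g, MeasurePreserving (τ t g) (prevMeasure P k) (prevMeasure P k))
    (hρ : ∀ t ∈ terms, ∀ (g : GaugeTransf P (k+1) U1) prev U φ,
      ρ' t (τ t g prev) (gaugeAct (fun x => g (blockOf x)) U) (twist (fun x => g (blockOf x)) φ) = ρ' t prev U φ)
    {ρL : GaugeField P (k+1) U1 → HiggsField P (k+1) → ℂ}
    (h : IsRT511 terms Qu (fun t _ U φ => qCov (barU k (bg42 k (w t) U)) φ) a ρ' ρL) (g : GaugeTransf P (k+1) U1) :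
    IsRT511 terms Qu (fun t _ U φ => qCov (barU k (bg42 k (w t) U)) φ) a ρ' (fun v ψ => ρL (gaugeAct g v) (twist g ψ)) :=
  isRT511_blockGauge_background (uk := fun t _ U => bg42 k (w t) U) hk hQu τ hτ hρ
    (fun _ g => fun x => g (blockOf (iterBlockOf k x)))
    (fun t _ g x => congrArg (fun z => g (blockOf z)) (iterBlockOf_embIter k (by omega) x))
    (fun t ht g _ U => bg42_gaugeAct (by omega) (hw t ht) (fun x => g (blockOf x)) U) h g

/-- The same WITH the axial gauge conditions (5.1.4) inserted (gen 5's `isRT511Ax_blockGauge`). [cite: BalabanImbrieJaffe1988, (4.17) p.277] -/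
theorem isRT511Ax_blockGauge_bg42 (hk : k + 1 ≤ P.m + P.K) (hw : ∀ t ∈ terms, GaugeInvariant (w t))
    (hQu : ∀ (g : GaugeTransf P (k+1) U1) U, Qu (gaugeAct (fun x => g (blockOf x)) U) = gaugeAct g (Qu U))
    (τ : ι → GaugeTransf P (k+1) U1 → Prev P k ≃ᵐ Prev P k)
    (hτ : ∀ t ∈ terms, ∀ g, MeasurePreserving (τ t g) (prevMeasure P k) (prevMeasure P k))
    (hρ : ∀ t ∈ terms, ∀ (g : GaugeTransf P (k+1) U1) prev U φ,
      ρ' t (τ t g prev) (gaugeAct (fun x => g (blockOf x)) U) (twist (fun x => g (blockOf x)) φ) = ρ' t prev U φ)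
    {ρL : GaugeField P (k+1) U1 → HiggsField P (k+1) → ℂ}
    (h : IsRT511Ax terms Qu (fun t _ U φ => qCov (barU k (bg42 k (w t) U)) φ) a ρ' ρL) (g : GaugeTransf P (k+1) U1) :
    IsRT511Ax terms Qu (fun t _ U φ => qCov (barU k (bg42 k (w t) U)) φ) a ρ' (fun v ψ => ρL (gaugeAct g v) (twist g ψ)) :=
  isRT511Ax_blockGauge_background (uk := fun t _ U => bg42 k (w t) U) hk hQu τ hτ hρ
    (fun _ g => fun x => g (blockOf (iterBlockOf k x)))
    (fun t _ g x => congrArg (fun z => g (blockOf z)) (iterBlockOf_embIter k (by omega) x))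
    (fun t ht g _ U => bg42_gaugeAct (by omega) (hw t ht) (fun x => g (blockOf x)) U) h g

/-- **EXISTENCE OF AN EXACTLY BLOCK-FIELD GAUGE INVARIANT `ρ̃^L_{k+1}` for (5.1.1) with the PRINTED `Qu` ([2] (2.10), r18's `qU`) and
`Q(u_k)φ` with `u_k` of the form (4.2)** (gen 6's `exists_isRT511_jointInvariant`, every hypothesis on the block averages and the background
discharged): measurable gauge-invariant `w_t`; `ρ′_t` jointly measurable, `𝒟u ⊗ Π𝒟u^{(j)} ⊗ 𝒟φ`-integrable and invariant under the (4.17)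
maps; `a > 0`, `d ≥ 2`, standing range. [cite: BalabanImbrieJaffe1988, (5.1.1) p.277] -/
theorem exists_isRT511_jointInvariant_bg42 (hk : k + 1 ≤ P.m + P.K) (ha : 0 < a) (hd : 2 ≤ P.d)
    (hwm : ∀ t ∈ terms, Measurable (w t)) (hw : ∀ t ∈ terms, GaugeInvariant (w t))
    (hρm : ∀ t ∈ terms, Measurable fun p : Prev P k × (GaugeField P k U1 × HiggsField P k) => ρ' t p.1 p.2.1 p.2.2)
    (hρi : ∀ t ∈ terms, Integrable (fun q : GaugeField P k U1 × (Prev P k × HiggsField P k) => ρ' t q.2.1 q.1 q.2.2)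
      ((fieldMeasure P k U1).prod ((prevMeasure P k).prod volume)))
    (τ : ι → GaugeTransf P (k+1) U1 → Prev P k ≃ᵐ Prev P k)
    (hτ : ∀ t ∈ terms, ∀ g, MeasurePreserving (τ t g) (prevMeasure P k) (prevMeasure P k))
    (hρ : ∀ t ∈ terms, ∀ (g : GaugeTransf P (k+1) U1) prev U φ,
      ρ' t (τ t g prev) (gaugeAct (fun x => g (blockOf x)) U) (twist (fun x => g (blockOf x)) φ) = ρ' t prev U φ) :
    ∃ ρL : GaugeField P (k+1) U1 → HiggsField P (k+1) → ℂ,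
      IsRT511 terms qU (fun t _ U φ => qCov (barU k (bg42 k (w t) U)) φ) a ρ' ρL ∧ JointInvariant ρL ∧ Measurable (uncurry ρL) ∧
        Integrable (uncurry ρL) ((fieldMeasure P (k+1) U1).prod volume) :=
  exists_isRT511_jointInvariant_background (uk := fun t _ U => bg42 k (w t) U) hk ha hd
    (fun t ht => (measurable_bg42 (hwm t ht)).comp measurable_snd) hρm hρi τ hτ hρ
    (fun _ g => fun x => g (blockOf (iterBlockOf k x)))
    (fun t _ g x => congrArg (fun z => g (blockOf z)) (iterBlockOf_embIter k (by omega) x))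
    (fun t ht g _ U => bg42_gaugeAct (by omega) (hw t ht) (fun x => g (blockOf x)) U)

/-- The axial version (gen 6's `exists_isRT511Ax_jointInvariant`). [cite: BalabanImbrieJaffe1988, (5.1.4) p.278] -/
theorem exists_isRT511Ax_jointInvariant_bg42 (hk : k + 1 ≤ P.m + P.K) (ha : 0 < a) (hd : 2 ≤ P.d)
    (hwm : ∀ t ∈ terms, Measurable (w t)) (hw : ∀ t ∈ terms, GaugeInvariant (w t))
    (hρm : ∀ t ∈ terms, Measurable fun p : Prev P k × (GaugeField P k U1 × HiggsField P k) => ρ' t p.1 p.2.1 p.2.2)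
    (hρi : ∀ t ∈ terms, Integrable (fun q : GaugeField P k U1 × (Prev P k × HiggsField P k) => ρ' t q.2.1 q.1 q.2.2)
      ((axialMeasure P k U1).prod ((prevMeasure P k).prod volume)))
    (τ : ι → GaugeTransf P (k+1) U1 → Prev P k ≃ᵐ Prev P k)
    (hτ : ∀ t ∈ terms, ∀ g, MeasurePreserving (τ t g) (prevMeasure P k) (prevMeasure P k))
    (hρ : ∀ t ∈ terms, ∀ (g : GaugeTransf P (k+1) U1) prev U φ,
      ρ' t (τ t g prev) (gaugeAct (fun x => g (blockOf x)) U) (twist (fun x => g (blockOf x)) φ) = ρ' t prev U φ) :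
    ∃ ρL : GaugeField P (k+1) U1 → HiggsField P (k+1) → ℂ,
      IsRT511Ax terms qU (fun t _ U φ => qCov (barU k (bg42 k (w t) U)) φ) a ρ' ρL ∧ JointInvariant ρL ∧ Measurable (uncurry ρL) ∧
        Integrable (uncurry ρL) ((fieldMeasure P (k+1) U1).prod volume) :=
  exists_isRT511Ax_jointInvariant_background (uk := fun t _ U => bg42 k (w t) U) hk ha hd
    (fun t ht => (measurable_bg42 (hwm t ht)).comp measurable_snd) hρm hρi τ hτ hρ
    (fun _ g => fun x => g (blockOf (iterBlockOf k x)))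
    (fun t _ g x => congrArg (fun z => g (blockOf z)) (iterBlockOf_embIter k (by omega) x))
    (fun t ht g _ U => bg42_gaugeAct (by omega) (hw t ht) (fun x => g (blockOf x)) U)

end Assembly


/-! ## §4 (v1.1) Fully printed instances: ONE history-free term, `ρ′ = ρ₀ = F e^{−S}` of (3.7) -/

section Single

variable {k : ℕ} {a : ℝ}

/-- **ONE HISTORY-FREE TERM with the printed `Qu`, the kernel `Q(u_k)φ` of a (4.2)-shaped background, and a term density `ρ₀(u, φ)`
ignoring the earlier fields**: if `ρ₀` is jointly measurable, `𝒟u𝒟φ`-integrable and jointly gauge invariant ([2] (2.7)), and the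
correction factor `w` is measurable and gauge invariant, there is an EXACTLY block-field gauge invariant, measurable, `dv dψ`-integrable
`ρ̃` satisfying (5.1.1) (`a > 0`, `d ≥ 2`, standing range) — §3 with `terms = {•}`, `τ = id`; the `Π𝒟u^{(j)}`-integral of a constant
is harmless (`prevMeasure` is a probability measure). [cite: BalabanImbrieJaffe1988, (5.1.1) p.277] -/
theorem exists_isRT511_jointInvariant_bg42_single (hk : k + 1 ≤ P.m + P.K) (ha : 0 < a) (hd : 2 ≤ P.d)
    {ρ₀ : GaugeField P k U1 → HiggsField P k → ℂ} (hρm : Measurable (uncurry ρ₀))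
    (hρi : Integrable (uncurry ρ₀) ((fieldMeasure P k U1).prod volume)) (hρg : JointInvariant ρ₀)
    {w : GaugeField P k U1 → GaugeField P 0 U1} (hwm : Measurable w) (hw : GaugeInvariant w) :
    ∃ ρL : GaugeField P (k+1) U1 → HiggsField P (k+1) → ℂ,
      IsRT511 (Finset.univ : Finset Unit) qU (fun _ _ U φ => qCov (barU k (bg42 k w U)) φ) a (fun _ _ => ρ₀) ρL ∧
        JointInvariant ρL ∧ Measurable (uncurry ρL) ∧ Integrable (uncurry ρL) ((fieldMeasure P (k+1) U1).prod volume) := by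
  have hσ : MeasurePreserving
      (Prod.map id Prod.snd : GaugeField P k U1 × (Prev P k × HiggsField P k) → GaugeField P k U1 × HiggsField P k)
      ((fieldMeasure P k U1).prod ((prevMeasure P k).prod volume)) ((fieldMeasure P k U1).prod volume) :=
    (MeasurePreserving.id _).prod measurePreserving_snd
  have hρi' : Integrable (fun q : GaugeField P k U1 × (Prev P k × HiggsField P k) => ρ₀ q.1 q.2.2)
      ((fieldMeasure P k U1).prod ((prevMeasure P k).prod volume)) :=
    (hσ.integrable_comp hρi.aestronglyMeasurable).2 hρi
  exact exists_isRT511_jointInvariant_bg42 (terms := (Finset.univ : Finset Unit)) (w := fun _ => w) (ρ' := fun _ _ => ρ₀) hk ha hd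
    (fun _ _ => hwm) (fun _ _ => hw) (fun _ _ => hρm.comp measurable_snd) (fun _ _ => hρi')
    (fun _ _ => MeasurableEquiv.refl (Prev P k)) (fun _ _ _ => MeasurePreserving.id _)
    (fun _ _ g _ U φ => hρg (fun x => g (blockOf x)) U φ)

/-- **THE PRINTED MODEL, NO HYPOTHESIS LEFT ON THE RENORMALIZATION-TRANSFORMATION SIDE**: for the observables `F` of (3.1) (jointly
measurable, jointly gauge invariant, `|F(u, φ)| ≤ CΠ_x(1 + |φ(x)|)ⁿ`), the density `ρ₀ = F e^{−S}` of (3.7) (r18's `rho0`; measurability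
`measurable_rho0`, gauge invariance `rho0_gaugeAct`, integrability `BIJ88Rho0Integrable.integrable_rho0`), the printed block average `Qu`
([2] (2.10)) and the kernel `Q(u_k)φ` of ANY (4.2)-shaped background with measurable gauge-invariant correction factor (the printed
`exp[−ie_kη𝒟_{k,loc}∂*Q^{e*}_kf^{(k)}]`: `gaugeInvariant_expCorr`, `measurable_expCorr`), the renormalization transformation (5.1.1) HAS an
exactly block-field gauge invariant, measurable, integrable density `ρ̃^L_{k+1}` — `ε > 0`, `λ > 0`, `a > 0`, `d ≥ 2`, standing range.
[cite: BalabanImbrieJaffe1988, (5.1.1) p.277] -/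
theorem exists_isRT511_jointInvariant_bg42_rho0 (hk : k + 1 ≤ P.m + P.K) (ha : 0 < a) (hd : 2 ≤ P.d) {ε : ℝ} (hε : 0 < ε)
    (e : ℝ) {lam : ℝ} (hlam : 0 < lam) (dm2 E₀ E₁ : ℝ) {F : GaugeField P k U1 → HiggsField P k → ℂ}
    (hFm : Measurable (uncurry F)) (hFg : JointInvariant F) {C : ℝ} {n : ℕ}
    (hF : ∀ U φ, ‖F U φ‖ ≤ C * ∏ x : Balaban1983to89.Site P k, (1 + ‖φ x‖) ^ n)
    {w : GaugeField P k U1 → GaugeField P 0 U1} (hwm : Measurable w) (hw : GaugeInvariant w) :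
    ∃ ρL : GaugeField P (k+1) U1 → HiggsField P (k+1) → ℂ,
      IsRT511 (Finset.univ : Finset Unit) qU (fun _ _ U φ => qCov (barU k (bg42 k w U)) φ) a
          (fun _ _ => rho0 ε e lam dm2 E₀ E₁ F) ρL ∧
        JointInvariant ρL ∧ Measurable (uncurry ρL) ∧ Integrable (uncurry ρL) ((fieldMeasure P (k+1) U1).prod volume) :=
  exists_isRT511_jointInvariant_bg42_single hk ha hd (measurable_rho0 ε e lam dm2 E₀ E₁ hFm)
    (BIJ88Rho0Integrable.integrable_rho0 hε e hlam dm2 E₀ E₁ hFm hF) (fun g U φ => rho0_gaugeAct ε e lam dm2 E₀ E₁ hFg g U φ) hwm hw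

/-- The printed correction factor version: `u_k = (Q^{s*}_ku)·exp[−ie_kη(D f^{(k)})(·)]` for any map `D` of plaquette functions to real
η-bond fields that is measurable along `u ↦ f^{(k)}(u)` (`D = 𝒟_{k,loc}∂*Q^{e*}_k`, a linear map in (4.2)).
[cite: BalabanImbrieJaffe1988, (4.2) p.274] -/
theorem exists_isRT511_jointInvariant_expCorr_rho0 (hk : k + 1 ≤ P.m + P.K) (ha : 0 < a) (hd : 2 ≤ P.d) {ε : ℝ} (hε : 0 < ε)
    (e : ℝ) {lam : ℝ} (hlam : 0 < lam) (dm2 E₀ E₁ : ℝ) {F : GaugeField P k U1 → HiggsField P k → ℂ}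
    (hFm : Measurable (uncurry F)) (hFg : JointInvariant F) {C : ℝ} {n : ℕ}
    (hF : ∀ U φ, ‖F U φ‖ ≤ C * ∏ x : Balaban1983to89.Site P k, (1 + ‖φ x‖) ^ n) (ek η : ℝ)
    {D : (Balaban1983to89.Plaq P k → ℂ) → PBond P 0 → ℝ}
    (hD : Measurable fun U : GaugeField P k U1 => D (fun p => fieldStrength ek (plaqVar (cfg U) p))) :
    ∃ ρL : GaugeField P (k+1) U1 → HiggsField P (k+1) → ℂ,
      IsRT511 (Finset.univ : Finset Unit) qU
          (fun _ _ U φ => qCov (barU k (bg42 k (fun (U : GaugeField P k U1) (b : PBond P 0) =>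
            expU1 (-(ek * η * D (fun p => fieldStrength ek (plaqVar (cfg U) p)) b))) U)) φ) a
          (fun _ _ => rho0 ε e lam dm2 E₀ E₁ F) ρL ∧
        JointInvariant ρL ∧ Measurable (uncurry ρL) ∧ Integrable (uncurry ρL) ((fieldMeasure P (k+1) U1).prod volume) :=
  exists_isRT511_jointInvariant_bg42_rho0 hk ha hd hε e hlam dm2 E₀ E₁ hFm hFg hF (measurable_expCorr ek η hD)
    (gaugeInvariant_expCorr ek η D)

end Single

end

end Literature.MathematicalPhysics.QuantumFieldTheory.BalabanImbrieJaffe1984to88.BIJ88RT51Background42
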